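import Mathlib
import Literature.Analysis.FluidPDE.ObukhovCorrsinAnomalousDissipation
import HarnessLib

/-!
# Johansson–Sorella (2026): an autonomous `C^α(T³)` field whose anomalous dissipation measure in
time has a nontrivial absolutely continuous part (Theorem B)

Named fact (Literature is sorry-free; users take `(h : JohanssonSorella2026_thmB)`).

Source: C. J. P. Johansson, M. Sorella, *Nontrivial absolutely continuous part of anomalous dissipation
measures in time*, J. Differential Equations 453 (2026), 113912 = arXiv:2303.09486v3 (23 Feb 2026; same
labels "Theorem A/B"; the first arXiv version numbers them "Theorem 1/2") [cite: JohanssonSorella2026].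
Before this file the tree cited the paper in prose only (`AnomalousDissipation.lean`, module docstring,
for Thm. A = the `4d` Navier–Stokes statement). Statements (pages of arXiv v3):

* **Definition 1.7** (p. 6): "Let `d ∈ ℕ` and `f ∈ L²((0,1) × T^d)` we define the mean energy
  dissipation `D_T[f] = -½ d/dt ∫_{T^d} |f(x,t)|² dx`, which is a distribution `D_T[f] ∈ D'(0,1)`."
* **Theorem B** (pp. 6–7): "Let `α ∈ [0,1)` and `β > 0`, then there exists an autonomous
  divergence-free velocity field `u ∈ C^α(T³)` and an initial datum `θ_in ∈ C^∞(T³)` with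
  `∫_{T³} θ_in = 0`, `‖θ_in‖_{L²} = 1` such that the unique solutions `θ_κ` of the advection-diffusion
  equation (ADV-DIFF) [`∂ₜθ_κ + u·∇θ_κ = κΔθ_κ`, `θ_κ(0,·) = θ_in`] with initial datum `θ_in` exhibit
  anomalous dissipation (1.8) [`limsup_{κ→0} κ ∫₀¹ ∫ |∇θ_κ|² dx dt > 0`] and there exists a measure
  `μ_T ∈ M(0,1)` so that up to non-relabelled subsequences `D_T[θ_κ] ⇀ μ_T` (1.9) weakly* in the
  sense of measures. In addition, `‖μ_T‖_{TV} ≥ 1/4`, the absolutely continuous part of the measure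
  `μ_T` w.r.t. the Lebesgue measure `L¹` is non-trivial, its singular part `μ_{T,sing}` is such that
  `‖μ_{T,sing}‖_{TV} ≤ β` and `‖D_T[θ₀] - μ_T‖_{H^{-1}(0,1)} ≤ β` (1.10), where `θ₀` is the unique
  bounded solution of (ADV-DIFF) with `κ = 0`. Furthermore, `θ_κ ⇀* θ₀` weakly* in `L^∞((0,1) × T³)`
  and (up to not relabelled subsequences) we have the closeness `‖θ_κ - θ₀‖_{L^∞((0,1);L²(T³))} < β`,
  and `e(t) = ∫_{T³} |θ₀(t,x)|² dx` is smooth in `[0,1]` and it is such that `e(1) < e(0)`."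
* **Remark 1.8** (p. 7): for the solutions of (ADV-DIFF), `D_T[θ_κ](t) = κ ∫ |∇θ_κ(t,x)|² dx`, and a
  nontrivial absolutely continuous part of `μ_T` implies (1.8).
* §2 (p. 8): "`M(X)` for the space of Radon measures on a locally compact metric space `X` and
  `‖μ‖_{TV}` as the total variation of the measure `μ ∈ M(X)`."

This is the printed example whose dissipation measure in time is NOT purely atomic with a genuinely
absolutely continuous part (contrast: Hess-Childs–Rowan's universal total dissipator has a purely
atomic measure, arXiv:2501.18526 Remark 2.1; Armstrong–Vicol's and Burczak–Székelyhidi–Wu's are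
non-atomic, arXiv:2501.18526 §1.3 p. 4).

## Rendering (unit torus `T³ = UnitAddTorus (Fin 3)`, isotropic `κΔ`, as printed)

* The autonomous field is used as the time-independent drift `fun _ => u` of the tree's weak class
  `Torus.IsWeakScalarTransportOn 1 κ (fun _ => u) θ_in θ` (solutions on `T³ × [0,1)`, `θ ∈ L^∞_t L²_x`);
  "the unique solutions `θ_κ`" (for `κ > 0`, a bounded divergence-free drift and a smooth datum the
  weak solution is unique) = every weak solution; `κ = 0`: `θ₀` is A bounded weak solution of the
  transport equation — its printed uniqueness among bounded solutions is not restated as a clause,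
  `θ₀` being pinned down instead by the printed weak-* convergence `θ_κ ⇀* θ₀` of the whole family.
* `u ∈ C^α(T³)` divergence free: `u` continuous (`α = 0` allowed) and `α`-Hölder with some constant,
  weakly divergence free (`Torus.IsWeaklyDivFree`).
* (1.8) is the tree's `Torus.HasAnomalousScalarDissipation 1 (fun _ => u) θ_in` (Colombo–Crippa–Sorella's
  `limsup` notion, `ObukhovCorrsinAnomalousDissipation.lean`).
* `D_T[θ]` (Def. 1.7) enters only through its distributional pairing with test functions
  `φ ∈ C_c^∞((0,1))`: `⟨D_T[θ], φ⟩ = ½ ∫₀¹ ‖θ(t)‖²_{L²} φ'(t) dt` (`JohanssonSorella2026.dissipationPairing`),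
  which needs `θ(t) ∈ L²` for a.e. `t` only. "`D_T[θ_κ] ⇀ μ_T` weakly* in the sense of measures
  (up to a subsequence)" is typed along an explicit sequence `κⱼ → 0⁺` as convergence of these
  pairings to `∫ φ dμ_T` for every `φ ∈ C_c^∞((0,1))` (recorded weakening 1). `μ_T ∈ M(0,1)` is a
  finite (positive) Borel measure on `ℝ` carried by `(0,1)` (the `D_T[θ_κ]` are nonnegative, Remark
  1.8, so is their limit); `‖μ_T‖_{TV} = μ_T(ℝ)`; the Lebesgue decomposition is Mathlib's
  (`μ_T = μ_T.singularPart vol + vol.withDensity (μ_T.rnDeriv vol)`): "absolutely continuous part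
  non-trivial" = `vol.withDensity (μ_T.rnDeriv vol) ≠ 0`, "`‖μ_{T,sing}‖_{TV} ≤ β`" =
  `μ_T.singularPart vol (univ) ≤ β`.
* `H^{-1}(0,1)` (dual of `H¹₀(0,1)`): (1.10) is typed by testing on `C_c^∞((0,1))` (dense in `H¹₀`):
  `|⟨D_T[θ₀], φ⟩ - ∫ φ dμ_T| ≤ β ‖φ‖_{H¹}` with `‖φ‖²_{H¹} = ∫₀¹ φ² + φ'²` and, `e` being smooth,
  `⟨D_T[θ₀], φ⟩ = ½ ∫₀¹ e φ'`. Since `β > 0` is arbitrary in the theorem, the choice among the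
  equivalent norms of `H¹₀(0,1)` is immaterial.
* "`e` is smooth in `[0,1]`": a `C^∞` function `e` on `[0,1]` with `e(t) = ‖θ₀(t)‖²_{L²}` for a.e.
  `t ∈ (0,1)` (weak solutions are a.e.-defined in time), `e(1) < e(0)`.
* "`θ_κ ⇀* θ₀` weakly* in `L^∞((0,1) × T³)`" (the whole family): along EVERY sequence `κ'ⱼ → 0⁺`, the
  weak solutions pair against every `φ ∈ L¹((0,1) × T³)` (`Torus.slabMeasure`) with limit the pairing
  of `θ₀` (the convention of `Torus.IsScalarLimitPoint`).

## Recorded weakenings / readings (never a strengthening)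

1. Weak-* convergence of measures is tested on `C_c^∞((0,1))` through the distributional pairing
   of Def. 1.7 rather than on all of `C_c((0,1))` — implied by the printed statement (for the viscous
   solutions `D_T[θ_κ]` is the nonnegative function `κ‖∇θ_κ(t)‖²`, Remark 1.8, whose pairing with
   `φ` is `½ ∫ ‖θ_κ‖² φ'` by the energy identity); the converse (density plus the uniform mass bound
   `≤ ½`) is not typed.
2. The subsequence clauses ((1.9) and the `L^∞_t L²_x` closeness) are typed along ONE common
   sequence `κⱼ → 0⁺` (a further subsequence serves both); the closeness `< β` is typed as
   `‖θ_{κⱼ}(t) - θ₀(t)‖²_{L²} ≤ β²` for a.e. `t ∈ (0,1)` and every `j` (essential supremum, non-strict).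
3. `θ₀`'s uniqueness among bounded weak solutions (printed "the unique bounded solution") is not a
   typed clause (see *Rendering*); `θ₀` is typed as a bounded weak solution that is the weak-* limit.

## Not typed here (with reasons)

* Theorem A (pp. 3–4; `4d` Navier–Stokes with `ν`-dependent time-independent forces `F_ν → F₀` in
  `C^α`, dissipation measure `μ ∈ M((0,1) × T⁴)` with `π_# μ` having an a.c. part, closeness to the
  Duchon–Robert distribution in `H^{-1}_{t,x}`): the forced-Navier–Stokes side of the summit's
  literature (`AnomalousDissipation.lean` discusses it under Bruè–De Lellis Question 2.2); Open
  Questions 1–3 (pp. 4–7) are open problems (not Literature): OQ3 asks for an autonomous `u ∈ L^∞(T²)`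
  (or `C^α(T²)`) and `θ_in ∈ L^∞` with (1.8) in TWO dimensions.
* §7 Prop. 7.1 / Cor. 7.2 (Duchon–Robert distribution vs. anomalous dissipation measure).
-/

noncomputable section

namespace Literature.Analysis.FluidPDE

open _root_.MeasureTheory _root_.Set _root_.Filter
open scoped NNReal ENNReal Topology ContDiff

namespace JohanssonSorella2026

/-- Smooth test functions of time compactly supported in the open interval `(0,1)`
(`φ ∈ C_c^∞((0,1))`, the test class of `D'(0,1)` in Def. 1.7). [cite: JohanssonSorella2026, Def. 1.7 p. 6] -/
def IsTimeTest (φ : ℝ → ℝ) : Prop :=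
  ContDiff ℝ ∞ φ ∧ HasCompactSupport φ ∧ tsupport φ ⊆ Ioo 0 1

/-- **The pairing of the mean energy dissipation `D_T[θ] = -½ d/dt ∫ |θ(t)|²` (Def. 1.7) with a test
function**: `⟨D_T[θ], φ⟩ = ½ ∫₀¹ ‖θ(t)‖²_{L²(T³)} φ'(t) dt` (distributional derivative moved onto `φ`).
Meaningful for `θ(t) ∈ L²` a.e. (`Torus.scalarL2Sq` has junk `0` off `L²`). [cite: JohanssonSorella2026, Def. 1.7 p. 6] -/
def dissipationPairing (θ : ℝ → UnitAddTorus (Fin 3) → ℝ) (φ : ℝ → ℝ) : ℝ :=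
  1 / 2 * ∫ t in Ioo (0 : ℝ) 1, Torus.scalarL2Sq (θ t) * deriv φ t

/-- The `H¹(0,1)` norm `(∫₀¹ φ² + φ'²)^{1/2}` of a test function (the norm of `H¹₀(0,1)`, whose dual is
the `H^{-1}(0,1)` of (1.10)). [cite: JohanssonSorella2026, Thm. B (1.10) p. 6] -/
def timeH1Norm (φ : ℝ → ℝ) : ℝ :=
  Real.sqrt (∫ t in Ioo (0 : ℝ) 1, (φ t ^ 2 + deriv φ t ^ 2))

/-- **The carrier class of Theorem B**: an autonomous velocity field `u ∈ C^α(T³)` (continuous — the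
case `α = 0` is allowed — and `α`-Hölder with some constant) which is (weakly) divergence free.
[cite: JohanssonSorella2026, Thm. B p. 6] -/
def IsCarrier (α : ℝ≥0) (u : UnitAddTorus (Fin 3) → EuclideanSpace ℝ (Fin 3)) : Prop :=
  Continuous u ∧ (∃ C : ℝ≥0, HolderWith C α u) ∧ FunctionSpaces.Torus.IsWeaklyDivFree u

/-- **The dissipation-measure clauses of Theorem B** for an autonomous drift `u`, a datum `θ_in` and a
tolerance `β`, along a sequence `κⱼ → 0⁺`, with limit measure `μ_T`, transport solution `θ₀` and
energy profile `e` (module docstring, *Rendering*):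
(1.9) for the weak solutions `θⱼ` with diffusivities `κⱼ`, `⟨D_T[θⱼ], φ⟩ → ∫ φ dμ_T` for every
`φ ∈ C_c^∞((0,1))`; `μ_T` finite, carried by `(0,1)`, `‖μ_T‖_{TV} ≥ 1/4`, absolutely continuous part
non-trivial, `‖μ_{T,sing}‖_{TV} ≤ β`; `θ₀` a bounded weak solution of the transport equation (`κ = 0`)
which is the weak-* limit in `L^∞((0,1) × T³)` of the weak solutions along EVERY sequence of
diffusivities tending to `0⁺`; closeness `‖θⱼ(t) - θ₀(t)‖²_{L²} ≤ β²` for a.e. `t` and all `j`;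
`e ∈ C^∞([0,1])` with `e(t) = ‖θ₀(t)‖²_{L²}` for a.e. `t ∈ (0,1)` and `e(1) < e(0)`;
(1.10) `|½ ∫₀¹ e φ' - ∫ φ dμ_T| ≤ β ‖φ‖_{H¹}` for every `φ ∈ C_c^∞((0,1))`. [cite: JohanssonSorella2026, Thm. B (1.9)–(1.10) pp. 6–7; Def. 1.7 p. 6; Rem. 1.8 p. 7] -/
def HasACDissipationMeasure (u : UnitAddTorus (Fin 3) → EuclideanSpace ℝ (Fin 3))
    (θin : UnitAddTorus (Fin 3) → ℝ) (β : ℝ) (κ : ℕ → ℝ) (μT : Measure ℝ)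
    (θ₀ : ℝ → UnitAddTorus (Fin 3) → ℝ) (e : ℝ → ℝ) : Prop :=
  (∀ j, 0 < κ j) ∧ Tendsto κ atTop (𝓝 0) ∧
  (∀ θ : ℕ → ℝ → UnitAddTorus (Fin 3) → ℝ,
    (∀ j, Torus.IsWeakScalarTransportOn 1 (κ j) (fun _ => u) θin (θ j)) →
      ∀ φ : ℝ → ℝ, IsTimeTest φ →
        Tendsto (fun j => dissipationPairing (θ j) φ) atTop (𝓝 (∫ t, φ t ∂μT))) ∧
  IsFiniteMeasure μT ∧ μT (Ioo 0 1)ᶜ = 0 ∧ ENNReal.ofReal (1 / 4) ≤ μT univ ∧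
  volume.withDensity (μT.rnDeriv volume) ≠ 0 ∧
  μT.singularPart volume univ ≤ ENNReal.ofReal β ∧
  Torus.IsWeakScalarTransportOn 1 0 (fun _ => u) θin θ₀ ∧
  (∃ B : ℝ, ∀ (t : ℝ) (x : UnitAddTorus (Fin 3)), abs (θ₀ t x) ≤ B) ∧
  (∀ (κ' : ℕ → ℝ) (θ : ℕ → ℝ → UnitAddTorus (Fin 3) → ℝ),
    (∀ j, 0 < κ' j) → Tendsto κ' atTop (𝓝 0) →
    (∀ j, Torus.IsWeakScalarTransportOn 1 (κ' j) (fun _ => u) θin (θ j)) →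
      ∀ φ : ℝ × UnitAddTorus (Fin 3) → ℝ, Integrable φ (Torus.slabMeasure (Fin 3) 1) →
        Tendsto (fun j => ∫ z, Function.uncurry (θ j) z * φ z ∂(Torus.slabMeasure (Fin 3) 1))
          atTop (𝓝 (∫ z, Function.uncurry θ₀ z * φ z ∂(Torus.slabMeasure (Fin 3) 1)))) ∧
  (∀ θ : ℕ → ℝ → UnitAddTorus (Fin 3) → ℝ,
    (∀ j, Torus.IsWeakScalarTransportOn 1 (κ j) (fun _ => u) θin (θ j)) →
      ∀ j, ∀ᵐ t ∂(volume.restrict (Ioo (0 : ℝ) 1)),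
        Torus.scalarL2Sq (θ j t - θ₀ t) ≤ β ^ 2) ∧
  ContDiffOn ℝ ∞ e (Icc 0 1) ∧
  (∀ᵐ t ∂(volume.restrict (Ioo (0 : ℝ) 1)), Torus.scalarL2Sq (θ₀ t) = e t) ∧ e 1 < e 0 ∧
  (∀ φ : ℝ → ℝ, IsTimeTest φ →
    abs (1 / 2 * (∫ t in Ioo (0 : ℝ) 1, e t * deriv φ t) - ∫ t, φ t ∂μT) ≤ β * timeH1Norm φ)

end JohanssonSorella2026

/-- **Johansson–Sorella 2026, Theorem B (an autonomous field with an absolutely continuous part of the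
dissipation measure in time)**: for every `α ∈ [0,1)` and `β > 0` there are an autonomous
divergence-free `u ∈ C^α(T³)` (`JohanssonSorella2026.IsCarrier α u`) and a smooth mean-zero datum
`θ_in` with `‖θ_in‖_{L²} = 1` such that the unique solutions of `∂ₜθ_κ + u·∇θ_κ = κΔθ_κ`,
`θ_κ(0) = θ_in`, dissipate anomalously — `limsup_{κ→0} κ ∫₀¹ ‖∇θ_κ‖² > 0`
(`Torus.HasAnomalousScalarDissipation 1 (fun _ => u) θ_in`) — and, along a sequence `κⱼ → 0⁺`, the
mean energy dissipations `D_T[θ_{κⱼ}]` (Def. 1.7) converge to a measure `μ_T` on `(0,1)` with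
`‖μ_T‖_{TV} ≥ 1/4`, NON-TRIVIAL ABSOLUTELY CONTINUOUS PART, singular part of mass `≤ β`, within `β`
of `D_T[θ₀] = -½ e'` in `H^{-1}(0,1)`, where `θ₀` — a bounded transport solution, the weak-* limit of
the `θ_κ` — has a SMOOTH energy profile `e` on `[0,1]` with `e(1) < e(0)`, and
`‖θ_{κⱼ} - θ₀‖_{L^∞_t L²_x} ≤ β` (`JohanssonSorella2026.HasACDissipationMeasure`, where the rendering
and the recorded weakenings are spelled out). Source form quoted in the module docstring. [cite: JohanssonSorella2026, Thm. B pp. 6–7 (arXiv v3 = JDE labels); Def. 1.7 p. 6; Rem. 1.8 p. 7; §2 p. 8] -/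
def JohanssonSorella2026_thmB : Prop :=
  ∀ α : ℝ≥0, α < 1 → ∀ β : ℝ, 0 < β →
    ∃ (u : UnitAddTorus (Fin 3) → EuclideanSpace ℝ (Fin 3)) (θin : UnitAddTorus (Fin 3) → ℝ),
      JohanssonSorella2026.IsCarrier α u ∧
      FunctionSpaces.Torus.IsSmooth θin ∧ ∫ x, θin x = 0 ∧ Torus.scalarL2Sq θin = 1 ∧
      Torus.HasAnomalousScalarDissipation 1 (fun _ => u) θin ∧
      ∃ (κ : ℕ → ℝ) (μT : Measure ℝ) (θ₀ : ℝ → UnitAddTorus (Fin 3) → ℝ) (e : ℝ → ℝ),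
        JohanssonSorella2026.HasACDissipationMeasure u θin β κ μT θ₀ e

end Literature.Analysis.FluidPDE

end
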